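import Summits.Ventures.CertifiedManyBodySolver.Observables.CanonicalCeilingW32K4o7SourcedRowG6o7
import Summits.Ventures.CertifiedManyBodySolver.Observables.CanonicalCeilingA0W32K4o7SourcedRows
import HarnessLib

/-!
# CEILING SLOTS 3 — the two TWO-SIDABLE floor cells that lacked a typed ceiling: t′ = 0 @ h_tree 0.25032 (`Re ω(P₀^d) ≤ 0.9080649`, xh line vs row 6/7) and A0 @ 0.26870 (`≤ 0.9238430`, A0 b0 line vs row 5/7)

Cell hubbard-cq (rung CQ, CQ-TABLE canonical `t′ = 0` / A0 columns, CEILING side; row «h-chord transport nodes», seat hubbard-cq-obsth-2 g23, 2026-08-29), on the lead's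
WAKE `wake/WAKE-hubbard-cq-obsth-2-20260829T0548Z.md` ADDENDUM 1 (anomaly-1 g32 ★ RESULT #2, cq STATUS 05:46:24Z, `g32/ceil/ceil_census30.py`: 0 dominated ceiling cells; TWO
two-sidable floor cells inside an eligible landed ceiling continuum's range with no typed ceiling instance; pre-elaboration draft `g32/slots/CeilSlots2.lean` 23418aa06b119e50).
Companion of floor eng-1's `CanonicalCeilingW32K4o7SourcedRowG6o7Slots2.lean` / `CanonicalCeilingA0W32K4o7SourcedRowsSlots.lean` (same parents, same premises, same slot rule;
separate small module). Parents BY NAME: `canonicalCeiling_n7o8_tp0_W32k4o7xh_of_row_g6o7` (p673017; `0 < g ≤ 2/7`) of `CanonicalCeilingW32K4o7SourcedRowG6o7.lean` and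
`canonicalCeilingA0_n7o8_tpm1o4_A0W32k4o7b0_of_row_g5o7` (`0 < g ≤ 2/7`) of `CanonicalCeilingA0W32K4o7SourcedRows.lean`. No new continuum, no new node, zero compute:

* `canonicalCeiling_n7o8_tp0_W32k4o7xh_decimal_g177o1000_r6o7` — g = 177/1000 (h_tree ≈ 0.25032): **≤ 0.9080649** (x ∈ (0.9080648347, 0.9080648348); numerator (A + B·g) − E = +1.746875656; floor cell of record 0.0058930 (R405; 0.0540282 once SLOTS5 books) — no ceiling typed at this field before)
* `canonicalCeilingA0_n7o8_tpm1o4_A0W32k4o7b0_decimal_g19o100_r5o7` — g = 19/100 (h_tree ≈ 0.26870): **≤ 0.9238430** (x ∈ (0.9238429614, 0.9238429615); numerator (A + B·g) − E = +1.369970363; A0 floor cell of record 0.0184352 (0.0226120 after R5-I) — no ceiling typed at this field before)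

Words = `⌈10⁷·x⌉/10⁷`, `x = ((A + B·g) − E)/(2·√2·(g₂ − g))` with the parents' typed ℚ literals PARSED FROM THE TREE, at BOTH ends `√2 ∈ (1.4142135623, 1.4142135624)` (asserted equal;
generator g23/gen_ceil3.py, stdlib `Fraction`; calibration: `canonicalCeiling_n7o8_tp0_W32k4o7xh_decimal_g3o16_r6o7` ↦ 0.9138611 reproduced; `canonicalCeilingA0_n7o8_tpm1o4_A0W32k4o7b0_decimal_g3o16_r5o7` ↦ 0.9220138 reproduced; second arithmetic = anomaly-1 RESULT #2, 2/2 digits ==), certified in Lean through the slot rule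
`chord_le_of_decimal_bound_s3` (re-declared privately, verbatim the parents' private rule; both words 7-dp TIGHT: `M − 10⁻⁷` violates the side condition).

SIZE, STATED PLAINLY: kinematic scale (≈ 0.91 / 0.92 against floors ≈ 0.05 / 0.02); CONSISTENT WITH ANY RESPONSE SHAPE below that scale, `m ≤ C·h` included. HONEST FRAMING:
finite-field RESPONSE ceilings at large pairing fields (h_p = 4·h_tree) on infinite-volume ground states at fixed density ⅞, CONDITIONAL by name on the κ 4/7 two-field(-diag-hop)
node (W5-CERTIFIED), the x2dk head cap node (refereed) and the anchoring energy rows (S1 dual certificate replayed / A0 sourced row as typed); a ceiling never speaks to presence;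
nothing about `h → 0`; never onset, gap, `T_c` or order; superconductivity in the Hubbard model is NOT proved or disproved by any of this. No definition; no named fact; no `sorry`.
References: R. B. Griffiths, Phys. Rev. 152 (1966) 240 §II; T. Koma, H. Tasaki, J. Stat. Phys. 76 (1994) 745 §1.
-/

noncomputable section

namespace Summit.Ventures.CertifiedManyBodySolver.Observables

open Matrix Finset Literature.Probability.LatticeModels
open Literature.MathematicalPhysics.QuantumLattice Literature.MathematicalPhysics.QuantumLattice.ThermodynamicLimit
open Literature.MathematicalPhysics.QuantumLattice.TwoCluster InfVolFermionState
open Summit.Ventures.CertifiedManyBodySolver Summit.Ventures.CertifiedManyBodySolver.Certificates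
open scoped ComplexOrder

section CeilSlots3

variable {ω : InfVolFermionState 2}

/-- `1.4142135623 < √2`. [folklore] -/
private theorem sqrt_two_gt_14142135623_s3 : (14142135623 / 10 ^ 10 : ℝ) < Real.sqrt 2 := by
  rw [Real.lt_sqrt (by norm_num)]; norm_num

/-- Slot rule for a ceiling (verbatim the parents' private rule): from `x ≤ N/(2(√2·g₂ − √2·g))` with `g < g₂`, `0 ≤ N` and the decidable side
condition `N·10¹⁰ ≤ M·2·14142135623·(g₂ − g)` conclude `x ≤ M`. [folklore] -/
private theorem chord_le_of_decimal_bound_s3 {x N g g₂ M : ℝ} (hgg : g < g₂) (hN : 0 ≤ N)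
    (hside : N * 10 ^ 10 ≤ M * (2 * 14142135623 * (g₂ - g))) (hx : x ≤ N / (2 * (Real.sqrt 2 * g₂ - Real.sqrt 2 * g))) : x ≤ M := by
  have hs := sqrt_two_gt_14142135623_s3
  have hδ : 0 < g₂ - g := sub_pos.2 hgg
  have hden : 0 < 2 * (Real.sqrt 2 * g₂ - Real.sqrt 2 * g) := by
    have : Real.sqrt 2 * g₂ - Real.sqrt 2 * g = Real.sqrt 2 * (g₂ - g) := by ring
    rw [this]; positivity
  refine hx.trans ?_
  rw [div_le_iff₀ hden]
  have hM : 0 ≤ M := by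
    by_contra hM'
    have : M * (2 * 14142135623 * (g₂ - g)) < 0 := mul_neg_of_neg_of_pos (not_le.mp hM') (by positivity)
    nlinarith
  nlinarith [mul_le_mul_of_nonneg_left hs.le (by positivity : (0:ℝ) ≤ M * (2 * (g₂ - g)))]

/-- **Ceiling slot at `g = 177/1000` (`h_tree ≈ 0.25032`), t′ = 0, xh line (κ 4/7 two-field node `cert_sgf_openbox32x4_U8_mu7o4_k4o7_j264563_twoField` read DOWN from g₀ = 2/7 ⊕ x2dk `cert_capTPx2dk_4x3_U8_tpm1o4_g3o14_mu5o2`) vs the FLOOR cell's S1 row E15 @ g₂ = 6/7 (`cert_pin1menuA0p_L3h0_U8_tp0_g6o7_E_j313009`): `Re ω(P₀^d) ≤ 0.9080649`** for every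
translation-invariant density-`7/8` minimiser of `E_{√2·177/1000}` (exact chord `0.9080648348…`, 7 dp UP, decidable through `1.4142135623 < √2`; floor cell of record 0.0058930 (R405; 0.0540282 once SLOTS5 books) — no ceiling typed at this field before).
Instance of `canonicalCeiling_n7o8_tp0_W32k4o7xh_of_row_g6o7`. CONDITIONAL by name on `cert_sgf_openbox32x4_U8_mu7o4_k4o7_j264563_twoField` + `cert_capTPx2dk_4x3_U8_tpm1o4_g3o14_mu5o2` + `cert_pin1menuA0p_L3h0_U8_tp0_g6o7_E_j313009`. Kinematic scale; a ceiling never speaks to presence. [cite: Griffiths1966, §II] -/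
theorem canonicalCeiling_n7o8_tp0_W32k4o7xh_decimal_g177o1000_r6o7 (hω : ω.IsTranslationInvariant) (hρ : ω.density = 7 / 8)
    (hmin : ∀ ω' : InfVolFermionState 2, ω'.IsTranslationInvariant → ω'.density = 7 / 8 →
      ω.meanEnergy (hubbardTTPrimeSourcedInteraction 1 0 8 0 dWaveFormFactor (Real.sqrt 2 * (177 / 1000 : ℝ))) 1 ≤
        ω'.meanEnergy (hubbardTTPrimeSourcedInteraction 1 0 8 0 dWaveFormFactor (Real.sqrt 2 * (177 / 1000 : ℝ))) 1)
    (hW : cert_sgf_openbox32x4_U8_mu7o4_k4o7_j264563_twoField) (hC : cert_capTPx2dk_4x3_U8_tpm1o4_g3o14_mu5o2) (hN : cert_pin1menuA0p_L3h0_U8_tp0_g6o7_E_j313009) :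
    (ω.expect (pairRegion (insert (0 : Site 2) unitSteps) 0) (localPairAt (insert 0 unitSteps) dWaveFormFactor 0)).re ≤ (9080649 / 10000000 : ℝ) :=
  chord_le_of_decimal_bound_s3 (by norm_num) (by push_cast; norm_num) (by push_cast; norm_num)
    (canonicalCeiling_n7o8_tp0_W32k4o7xh_of_row_g6o7 (177 / 1000 : ℝ) (by norm_num) (by norm_num) hω hρ hmin hW hC hN)

/-- **Ceiling slot at `g = 19/100` (`h_tree ≈ 0.26870`), A0 t′ = −1/4, A0 b0 line (κ 4/7 diag-hop node `cert_sgf_openbox32x4_U8_mu7o4_k4o7_j264563_twoFieldDiagHop` read DOWN from g₀ = 2/7 ⊕ x2dk `cert_capTPx2dk_4x3_U8_tpm1o4_g3o14_mu5o2`) vs the A0 sourced row E(g₂) @ g₂ = 5/7 (`cert_pin2menuA0_L3_U8_tpm1o4_g5o7_E_plain_j287829`): `Re ω(P₀^d) ≤ 0.9238430`** for every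
translation-invariant density-`7/8` minimiser of `E^{−1/4}_{√2·19/100}` (exact chord `0.9238429615…`, 7 dp UP, decidable through `1.4142135623 < √2`; A0 floor cell of record 0.0184352 (0.0226120 after R5-I) — no ceiling typed at this field before).
Instance of `canonicalCeilingA0_n7o8_tpm1o4_A0W32k4o7b0_of_row_g5o7`. CONDITIONAL by name on `cert_sgf_openbox32x4_U8_mu7o4_k4o7_j264563_twoFieldDiagHop` + `cert_capTPx2dk_4x3_U8_tpm1o4_g3o14_mu5o2` + `cert_pin2menuA0_L3_U8_tpm1o4_g5o7_E_plain_j287829`. Kinematic scale; a ceiling never speaks to presence. [cite: Griffiths1966, §II] -/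
theorem canonicalCeilingA0_n7o8_tpm1o4_A0W32k4o7b0_decimal_g19o100_r5o7 (hω : ω.IsTranslationInvariant) (hρ : ω.density = 7 / 8)
    (hmin : ∀ ω' : InfVolFermionState 2, ω'.IsTranslationInvariant → ω'.density = 7 / 8 →
      ω.meanEnergy (hubbardTTPrimeSourcedInteraction 1 (-1 / 4) 8 0 dWaveFormFactor (Real.sqrt 2 * (19 / 100 : ℝ))) 1 ≤
        ω'.meanEnergy (hubbardTTPrimeSourcedInteraction 1 (-1 / 4) 8 0 dWaveFormFactor (Real.sqrt 2 * (19 / 100 : ℝ))) 1)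
    (hW : cert_sgf_openbox32x4_U8_mu7o4_k4o7_j264563_twoFieldDiagHop) (hC : cert_capTPx2dk_4x3_U8_tpm1o4_g3o14_mu5o2) (hN : cert_pin2menuA0_L3_U8_tpm1o4_g5o7_E_plain_j287829) :
    (ω.expect (pairRegion (insert (0 : Site 2) unitSteps) 0) (localPairAt (insert 0 unitSteps) dWaveFormFactor 0)).re ≤ (9238430 / 10000000 : ℝ) :=
  chord_le_of_decimal_bound_s3 (by norm_num) (by push_cast; norm_num) (by push_cast; norm_num)
    (canonicalCeilingA0_n7o8_tpm1o4_A0W32k4o7b0_of_row_g5o7 (19 / 100 : ℝ) (by norm_num) (by norm_num) hω hρ hmin hW hC hN)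

end CeilSlots3

end Summit.Ventures.CertifiedManyBodySolver.Observables

end
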